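import Literature.MathematicalPhysics.QuantumManyBody.GroundStateFeynmanKacWitnessBoundary
import Literature.MathematicalPhysics.QuantumManyBody.BoseGasHardSet
import Literature.Probability.Process.BrownianRunningSup
import HarnessLib

/-!
# Route BECCutLineWeakDisorder — `WitnessTransfer`, line `Sketch`: (E2) for strongly repulsive
hard sets

Support file (does not close the item) for the crux stmt-AtomisticToContinuum-14978
(`Summit.AtomisticToContinuum.BoseEinsteinCondensation.Theses.BECCutLineWeakDisorder.WitnessTransfer`).
The one open input of line `Sketch` is (E2) `stub_vanish`: `(e^{-TH_N}1)(X) → 0` uniformly as a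
relative position `xᵢ − xⱼ` approaches the hard set `hardVec v`. Here it is proved for potentials
that blow up at least like an inverse power `> 2` of the distance to each hard point,
`v(|w|) ≥ c · d^{-p}` whenever `dist(w, z) ≤ d < r₁` (`z ∈ hardVec v`, `p > 2`) — e.g.
Lennard-Jones-type cores `v(r) ≍ r^{-12}` (`hardVec v = {0}`), inverse-power hard shells, hard
spheres with an inverse-power skin. The argument uses only the running-supremum tail of the six
Brownian coordinates of the pair (`measure_runSup_ge_le`): with probability `≥ 1 − η/2` the pair
stays within `(10M+1)κ` of the hard point during the time `κ²`, where the action is then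
`≥ κ² · c ((10M+1)κ)^{-p} → ∞` as `κ → 0`.

* `stub_vanish_of_strongRepulsion` — (E2) for such `v`.
-/

noncomputable section

open MeasureTheory Filter Set Metric
open scoped ENNReal NNReal Topology

namespace Summit.AtomisticToContinuum.BoseEinsteinCondensation.Theorems.CutLineWitness

open Literature.MathematicalPhysics.QuantumManyBody.BoseGas
open Literature.Probability.Process

/-- `‖u‖ ≤ ∑ₖ |uₖ|` in `ℝ³`. [folklore] -/
theorem norm_le_sum_abs_space (u : Space) : ‖u‖ ≤ ∑ k, |u k| := by
  rw [EuclideanSpace.norm_eq]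
  refine Real.sqrt_le_iff.2 ⟨Finset.sum_nonneg fun k _ => abs_nonneg _, ?_⟩
  have h : ∀ k, ‖u k‖ ^ 2 = |u k| ^ 2 := fun k => by rw [Real.norm_eq_abs]
  simp only [h]
  exact Finset.sum_sq_le_sq_sum_of_nonneg fun k _ => abs_nonneg (u k)

/-- The displacement of one world-line is controlled by the running suprema of its three
Brownian coordinates: `‖B_i(s) − X_i‖ ≤ √2 ∑ₖ |b_s(ω i k)|`. [folklore] -/
theorem norm_worldLine_sub_le {N : ℕ} (X : Config N) (ω : PathSpace N) (s : ℝ≥0) (i : Fin N) :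
    ‖worldLine X ω s i - X i‖ ≤ Real.sqrt 2 * ∑ k, |brownian s (ω i k)| := by
  refine (norm_le_sum_abs_space _).trans (le_of_eq ?_)
  rw [Finset.mul_sum]
  refine Finset.sum_congr rfl fun k _ => ?_
  have h : (worldLine X ω s i - X i) k = Real.sqrt 2 * brownian s (ω i k) := by
    rw [PiLp.sub_apply, worldLine_apply_apply]; ring
  rw [h, abs_mul, abs_of_nonneg (Real.sqrt_nonneg _)]

/-- Probability that one Brownian coordinate of the world-lines has running supremum `≥ a` by
time `h`: the canonical tail `measure_runSup_ge_le`. [folklore] -/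
theorem measure_runSup_coord_ge_le {N : ℕ} (i : Fin N) (k : Fin 3) (h : ℝ≥0) {a : ℝ}
    (ha0 : 0 ≤ a) (ha : (h : ℝ) < (a / 2) ^ 2) :
    wienerPaths N {ω | a ≤ runSup h (ω i k)} ≤
      ENNReal.ofReal (2 * (h : ℝ) ^ 2 / ((a / 2) ^ 2 - h) ^ 2) := by
  have hset : {ω : PathSpace N | a ≤ runSup h (ω i k)} =
      (fun ω : PathSpace N => ω i k) ⁻¹' {p | a ≤ runSup h p} := rfl
  rw [hset, (measurePreserving_apply₂ (N := N) i k).measure_preimage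
    (measurableSet_le measurable_const (measurable_runSup h)).nullMeasurableSet]
  exact measure_runSup_ge_le h ha0 ha

/-- **(E2) for strongly repulsive hard sets.** If near every hard point `z ∈ hardVec v` the
potential dominates an inverse power `> 2` of the distance, `v(|w|) ≥ c d^{-p}` whenever
`dist(w, z) ≤ d < r₁`, `d > 0`, then for `T > 0`, `η > 0` there is `κ > 0` such that
`(e^{-TH_N}1)(X) ≤ η` whenever some `xᵢ − xⱼ` (`i ≠ j`) is within `κ` of the hard set.
[cite: ChungZhao1995, Thm 3.17] -/
theorem stub_vanish_of_strongRepulsion {N : ℕ} {v : ℝ → ℝ≥0∞} {p c r₁ : ℝ} (hp : 2 < p)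
    (hc : 0 < c) (hr₁ : 0 < r₁)
    (hrep : ∀ z ∈ hardVec v, ∀ w : Space, ∀ d : ℝ, 0 < d → d < r₁ → dist w z ≤ d →
      ENNReal.ofReal (c * d ^ (-p)) ≤ v ‖w‖)
    (L : ℝ) {T : ℝ} (hT : 0 < T) {η : ℝ} (hη : 0 < η) :
    ∃ κ : ℝ, 0 < κ ∧ ∀ X : Config N,
      (∃ i j : Fin N, i ≠ j ∧ ∃ z ∈ hardVec v, dist (X i - X j) z < κ) →
        fkSemigroup v L T (fun _ => (1 : ℝ≥0∞)) X ≤ ENNReal.ofReal η := by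
  -- the window parameter `M` (tail of the six running suprema `≤ η/2`)
  set M : ℝ := max 4 (1536 / η + 1) with hMdef
  have hM4 : 4 ≤ M := le_max_left _ _
  have hM0 : 0 < M := by linarith
  have hMη : 768 / M ^ 4 ≤ η / 2 := by
    have h1 : 1536 / η + 1 ≤ M := le_max_right _ _
    have h2 : 1536 / η ≤ M := by linarith
    have h3 : M ≤ M ^ 4 := by
      calc M = M * 1 * 1 * 1 := by ring
        _ ≤ M * M * M * M := by gcongr <;> linarith
        _ = M ^ 4 := by ring
    rw [div_le_iff₀ (by positivity)]
    rw [div_le_iff₀ hη] at h2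
    nlinarith
  set ρ : ℝ := 10 * M + 1 with hρdef
  have hρ0 : 0 < ρ := by rw [hρdef]; positivity
  -- the action scale `Λ`
  set Λ : ℝ := max (Real.log (2 / η)) 1 with hΛdef
  have hΛ1 : 1 ≤ Λ := le_max_right _ _
  have hΛ0 : 0 < Λ := one_pos.trans_le hΛ1
  -- `κ`
  set κ₁ : ℝ := min (Real.sqrt T) (r₁ / (2 * ρ)) with hκ₁def
  set κ₂ : ℝ := (c * ρ ^ (-p) / Λ) ^ (1 / (p - 2)) with hκ₂def
  have hκ₂0 : 0 < κ₂ := Real.rpow_pos_of_pos (div_pos (mul_pos hc (Real.rpow_pos_of_pos hρ0 _)) hΛ0) _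
  set κ : ℝ := min κ₁ κ₂ with hκdef
  have hκ0 : 0 < κ := lt_min (lt_min (Real.sqrt_pos.2 hT) (by positivity)) hκ₂0
  have hκT : κ ^ 2 ≤ T := by
    have h1 : κ ≤ Real.sqrt T := (min_le_left _ _).trans (min_le_left _ _)
    calc κ ^ 2 ≤ Real.sqrt T ^ 2 := pow_le_pow_left₀ hκ0.le h1 2
      _ = T := Real.sq_sqrt hT.le
  have hκr : ρ * κ < r₁ := by
    have h1 : κ ≤ r₁ / (2 * ρ) := (min_le_left _ _).trans (min_le_right _ _)
    calc ρ * κ ≤ ρ * (r₁ / (2 * ρ)) := by gcongr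
      _ = r₁ / 2 := by field_simp
      _ < r₁ := by linarith
  have hκΛ : Λ ≤ c * ρ ^ (-p) * κ ^ (2 - p) := by
    -- `κ ≤ κ₂` and `2 - p < 0`
    have h1 : κ ≤ κ₂ := min_le_right _ _
    have hp2 : 0 < p - 2 := by linarith
    have h2 : κ₂ ^ (2 - p) ≤ κ ^ (2 - p) :=
      Real.rpow_le_rpow_of_nonpos hκ0 h1 (by linarith)
    have h3 : κ₂ ^ (2 - p) = Λ / (c * ρ ^ (-p)) := by
      rw [hκ₂def, ← Real.rpow_mul (div_pos (mul_pos hc (Real.rpow_pos_of_pos hρ0 _)) hΛ0).le,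
        show 1 / (p - 2) * (2 - p) = -1 by field_simp; ring, Real.rpow_neg_one, inv_div]
    have hcρ : 0 < c * ρ ^ (-p) := mul_pos hc (Real.rpow_pos_of_pos hρ0 _)
    calc Λ = c * ρ ^ (-p) * (Λ / (c * ρ ^ (-p))) := by field_simp
      _ = c * ρ ^ (-p) * κ₂ ^ (2 - p) := by rw [h3]
      _ ≤ c * ρ ^ (-p) * κ ^ (2 - p) := by gcongr
  refine ⟨κ, hκ0, fun X hX => ?_⟩
  obtain ⟨i, j, hij, z, hz, hyz⟩ := hX
  -- the time window and the level
  set τ : ℝ≥0 := ⟨κ ^ 2, sq_nonneg κ⟩ with hτdef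
  have hτcoe : ((τ : ℝ≥0) : ℝ) = κ ^ 2 := rfl
  set m : ℝ := M * κ with hmdef
  have hm0 : 0 < m := mul_pos hM0 hκ0
  have hmτ : ((τ : ℝ≥0) : ℝ) < (m / 2) ^ 2 := by
    rw [hτcoe, hmdef, show (M * κ / 2) ^ 2 = (M ^ 2 / 4) * κ ^ 2 by ring]
    have hM2 : 16 ≤ M ^ 2 := by nlinarith
    nlinarith [sq_pos_of_pos hκ0]
  -- the bad event: some coordinate of the pair has running supremum `≥ m`
  set B : Set (PathSpace N) := ⋃ k : Fin 3, ({ω | m ≤ runSup τ (ω i k)} ∪ {ω | m ≤ runSup τ (ω j k)})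
    with hBdef
  have hBm : MeasurableSet B := MeasurableSet.iUnion fun k =>
    (measurableSet_le measurable_const ((measurable_runSup τ).comp
      ((measurable_pi_apply k).comp (measurable_pi_apply i)))).union
    (measurableSet_le measurable_const ((measurable_runSup τ).comp
      ((measurable_pi_apply k).comp (measurable_pi_apply j))))
  have htail : ∀ (i' : Fin N) (k : Fin 3), wienerPaths N {ω | m ≤ runSup τ (ω i' k)} ≤
      ENNReal.ofReal (128 / M ^ 4) := by
    intro i' k
    refine (measure_runSup_coord_ge_le i' k τ hm0.le hmτ).trans (ENNReal.ofReal_le_ofReal ?_)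
    rw [hτcoe, hmdef]
    have hden : (M * κ / 2) ^ 2 - κ ^ 2 = κ ^ 2 * (M ^ 2 / 4 - 1) := by ring
    have hq : M ^ 2 / 8 ≤ M ^ 2 / 4 - 1 := by nlinarith
    have hq0 : 0 < M ^ 2 / 4 - 1 := by nlinarith
    rw [hden, mul_pow, show (κ ^ 2) ^ 2 = κ ^ 4 by ring, show 2 * κ ^ 4 / (κ ^ 4 * (M ^ 2 / 4 - 1) ^ 2)
      = 2 / (M ^ 2 / 4 - 1) ^ 2 by field_simp]
    rw [div_le_div_iff₀ (by positivity) (by positivity)]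
    have h1 : (M ^ 2 / 8) ^ 2 ≤ (M ^ 2 / 4 - 1) ^ 2 := pow_le_pow_left₀ (by positivity) hq 2
    nlinarith
  have hPB : wienerPaths N B ≤ ENNReal.ofReal (η / 2) := by
    calc wienerPaths N B ≤ ∑ k : Fin 3, wienerPaths N
          ({ω | m ≤ runSup τ (ω i k)} ∪ {ω | m ≤ runSup τ (ω j k)}) := measure_iUnion_fintype_le _ _
      _ ≤ ∑ _k : Fin 3, (ENNReal.ofReal (128 / M ^ 4) + ENNReal.ofReal (128 / M ^ 4)) := by
          refine Finset.sum_le_sum fun k _ => (measure_union_le _ _).trans ?_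
          exact add_le_add (htail i k) (htail j k)
      _ = ENNReal.ofReal (768 / M ^ 4) := by
          rw [Finset.sum_const, Finset.card_univ, Fintype.card_fin, ← ENNReal.ofReal_add
            (by positivity) (by positivity), nsmul_eq_mul, Nat.cast_ofNat, ← ENNReal.ofReal_ofNat,
            ← ENNReal.ofReal_mul (by norm_num)]
          congr 1; ring
      _ ≤ ENNReal.ofReal (η / 2) := ENNReal.ofReal_le_ofReal hMη
  -- on the good event the action is large
  set A : ℝ := c * ρ ^ (-p) * κ ^ (2 - p) with hAdef
  have hgood : ∀ ω, ω ∉ B → ENNReal.ofReal A ≤ pathAction v T X ω := by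
    intro ω hω
    have hcoord : ∀ (k : Fin 3) (s : ℝ≥0), s ≤ τ →
        |brownian s (ω i k)| < m ∧ |brownian s (ω j k)| < m := by
      intro k s hs
      have h1 : ¬ (m ≤ runSup τ (ω i k)) := fun h => hω (Set.mem_iUnion.2 ⟨k, Or.inl h⟩)
      have h2 : ¬ (m ≤ runSup τ (ω j k)) := fun h => hω (Set.mem_iUnion.2 ⟨k, Or.inr h⟩)
      exact ⟨(abs_brownian_le_runSup hs _).trans_lt (not_le.1 h1),
        (abs_brownian_le_runSup hs _).trans_lt (not_le.1 h2)⟩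
    -- the pair stays within `ρ κ` of `z` up to time `τ`
    have hnear : ∀ s : ℝ≥0, s ≤ τ →
        dist (worldLine X ω s i - worldLine X ω s j) z ≤ ρ * κ := by
      intro s hs
      have hdi : ‖worldLine X ω s i - X i‖ ≤ Real.sqrt 2 * (3 * m) := by
        refine (norm_worldLine_sub_le X ω s i).trans ?_
        gcongr
        calc ∑ k, |brownian s (ω i k)| ≤ ∑ _k : Fin 3, m :=
              Finset.sum_le_sum fun k _ => (hcoord k s hs).1.le
          _ = 3 * m := by simp
      have hdj : ‖worldLine X ω s j - X j‖ ≤ Real.sqrt 2 * (3 * m) := by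
        refine (norm_worldLine_sub_le X ω s j).trans ?_
        gcongr
        calc ∑ k, |brownian s (ω j k)| ≤ ∑ _k : Fin 3, m :=
              Finset.sum_le_sum fun k _ => (hcoord k s hs).2.le
          _ = 3 * m := by simp
      have hs2 : Real.sqrt 2 ≤ 3 / 2 := by
        rw [Real.sqrt_le_left (by norm_num)]; norm_num
      calc dist (worldLine X ω s i - worldLine X ω s j) z
          ≤ dist (worldLine X ω s i - worldLine X ω s j) (X i - X j) + dist (X i - X j) z :=
            dist_triangle _ _ _
        _ ≤ (‖worldLine X ω s i - X i‖ + ‖worldLine X ω s j - X j‖) + κ := by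
            gcongr
            rw [dist_eq_norm, show worldLine X ω s i - worldLine X ω s j - (X i - X j) =
              (worldLine X ω s i - X i) - (worldLine X ω s j - X j) by abel]
            exact norm_sub_le _ _
        _ ≤ Real.sqrt 2 * (3 * m) + Real.sqrt 2 * (3 * m) + κ := by gcongr
        _ ≤ ρ * κ := by rw [hρdef, hmdef]; nlinarith [hm0, hκ0]
    -- the integrand is `≥ c (ρκ)^{-p}` on `(0, κ²]`
    have hint : ∀ s : ℝ, s ∈ Set.Ioc (0 : ℝ) (κ ^ 2) →
        ENNReal.ofReal (c * (ρ * κ) ^ (-p)) ≤ interaction v (worldLine X ω s.toNNReal) := by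
      intro s hs
      have hsτ : s.toNNReal ≤ τ := by
        rw [← NNReal.coe_le_coe, Real.coe_toNNReal s hs.1.le, hτcoe]; exact hs.2
      refine le_trans ?_ (apply_dist_le_interaction v _ hij)
      rw [dist_eq_norm]
      exact hrep z hz _ (ρ * κ) (mul_pos hρ0 hκ0) hκr (hnear _ hsτ)
    calc ENNReal.ofReal A = ENNReal.ofReal (c * (ρ * κ) ^ (-p)) * volume (Set.Ioc (0 : ℝ) (κ ^ 2)) := by
          rw [Real.volume_Ioc, sub_zero, ← ENNReal.ofReal_mul (by positivity), hAdef,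
            Real.mul_rpow hρ0.le hκ0.le]
          congr 1
          rw [show (2 : ℝ) - p = -p + 2 by ring, Real.rpow_add hκ0, Real.rpow_two]
          ring
      _ = ∫⁻ _s in Set.Ioc (0 : ℝ) (κ ^ 2), ENNReal.ofReal (c * (ρ * κ) ^ (-p)) :=
          (setLIntegral_const _ _).symm
      _ ≤ ∫⁻ s in Set.Ioc (0 : ℝ) (κ ^ 2), interaction v (worldLine X ω s.toNNReal) :=
          setLIntegral_mono' measurableSet_Ioc fun s hs => hint s hs
      _ ≤ pathAction v T X ω := lintegral_mono_set (Set.Ioc_subset_Ioc_right hκT)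
  -- `e^{-A} ≤ η/2`
  have hexpA : Real.exp (-A) ≤ η / 2 := by
    have h1 : Real.log (2 / η) ≤ A := (le_max_left _ _).trans (hκΛ.trans le_rfl)
    calc Real.exp (-A) ≤ Real.exp (-Real.log (2 / η)) := Real.exp_le_exp.2 (neg_le_neg h1)
      _ = η / 2 := by rw [Real.exp_neg, Real.exp_log (by positivity), inv_div]
  -- the weight is `≤ 1_B + e^{-A}`
  have hweight : ∀ ω, fkWeight v L T X ω ≤ B.indicator 1 ω + ENNReal.ofReal (Real.exp (-A)) := by
    intro ω
    by_cases hω : ω ∈ B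
    · rw [Set.indicator_of_mem hω]
      exact (fkWeight_le_one v L T X ω).trans le_self_add
    · rw [Set.indicator_of_notMem hω, zero_add]
      have h1 : fkWeight v L T X ω ≤ expNeg (pathAction v T X ω) :=
        Set.indicator_le_self _ _ ω
      refine h1.trans ((expNeg_antitone (hgood ω hω)).trans (le_of_eq ?_))
      have hA0 : 0 ≤ A := by
        rw [hAdef]; exact mul_nonneg (mul_nonneg hc.le (Real.rpow_nonneg hρ0.le _))
          (Real.rpow_nonneg hκ0.le _)
      rw [expNeg, if_neg ENNReal.ofReal_ne_top, ENNReal.toReal_ofReal hA0]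
  calc fkSemigroup v L T (fun _ => (1 : ℝ≥0∞)) X
      = ∫⁻ ω, fkWeight v L T X ω ∂wienerPaths N := by simp [fkSemigroup]
    _ ≤ ∫⁻ ω, (B.indicator 1 ω + ENNReal.ofReal (Real.exp (-A))) ∂wienerPaths N :=
        lintegral_mono hweight
    _ = wienerPaths N B + ENNReal.ofReal (Real.exp (-A)) := by
        rw [lintegral_add_right _ measurable_const, lintegral_indicator_one hBm, lintegral_const,
          measure_univ, mul_one]
    _ ≤ ENNReal.ofReal (η / 2) + ENNReal.ofReal (η / 2) :=
        add_le_add hPB (ENNReal.ofReal_le_ofReal hexpA)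
    _ = ENNReal.ofReal η := by rw [← ENNReal.ofReal_add (by positivity) (by positivity)]; ring_nf

end Summit.AtomisticToContinuum.BoseEinsteinCondensation.Theorems.CutLineWitness

end
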